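import Literature.MathematicalPhysics.QuantumFieldTheory.Balaban1983to89.Node00.BackgroundMapOfRecord
import Literature.MathematicalPhysics.QuantumFieldTheory.Balaban1983to89.Node00.CriticalOnFibreTangent
import Literature.MathematicalPhysics.QuantumFieldTheory.Balaban1983to89.Node00.MultiScaleFibreChart
import Literature.MathematicalPhysics.QuantumFieldTheory.Balaban1983to89.B9AdOrthogonal
import HarnessLib

/-!
# NODE 00 — `BgSchemeChartLie`: THE LIE-ALGEBRA READING OF THE [B11] PROP. 6 CHART — «U = U′U₀, U′ = exp(iηA′)» with
# `iηA′(b) ∈ 𝔰𝔲(N)`; REALITY OF THE FIXED POINT FROM REAL DATA; THE FLAT VALUE; Cⁿ-DEPENDENCE OF THE CHART ENTRIES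

Cell `pub-ymgap` (YM-PLAN Track A), seat `pub-ymgap-node00-def-Y` (g38; custodian of the `BgScheme` instance of record), answering ◆ CRIT-1
(nodeO l.5250: «two scheme-side letters are yours: `chartCfg S 1 = 1`, C² chart entries at 0»), ▶ PTC-1 (l.5271: «(s-exp) + tangent-criticality of
chart members are the instance-side letters the socket displays») and ◇ lens-1 (l.5274: «(s-exp) ⟺ `I • ev(sol V + 𝔄 V) b ∈ 𝔰𝔲(2)` near the flat
datum = the Lie-algebra form of `ChartSUTok`»).  [B11] = [Balaban1985Variational] (CMP **102** (1985) 277–309), [B9] = [Balaban1985Propagators2].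

WHAT.  For an abstract Prop. 6 scheme `S : BgScheme F N 𝒴 𝒵 K k` (`Node00.BackgroundMapOfRecord`: the data `𝒢 = 𝔊(U₀)`, `W = (δ∕δA′)V`, `J`, `𝔄`,
the presentation `ev` of the (115)-space as bond exponents, the fixed point `𝒜(V) = S.sol V` of (116) and its chart image `S.chartCfg V`,
`(chartCfg V)(b) = exp(i X(b)) · U₀(b)`, `X = ev(𝒜(V) + 𝔄(V))`):
* §1 THE LIE READING — `S.lieExpo V : bonds → 𝔰𝔲(N)`, the exponent `iX(b)` read in the Lie algebra through the real-linear retraction `suProj`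
  (`Node00.MultiScaleFibreChart`); the token `S.LieTokAt V` («`iX(b) ∈ 𝔰𝔲(N)` on every bond» — the Lie-algebra form of `ChartSUTok`, which it
  implies: `chartSUTok_of_lieTokAt`); and ★ `chartCfg_eq_expChart_one`: at a FLAT background `U₀ = 1` the chart image IS the exponential chart of
  `Node00.CriticalOnFibreTangent` at `1`, `S.chartCfg V = expChart 1 (S.lieExpo V)` — the seam «(s-exp)» between the scheme and the K0 tangent socket
  (`Summits/…/BalabanUVNodesK0AxTangentSocket`), with its eventual form along any datum map.
* §2 REALITY ⟹ THE LIE TOKEN — print's reality sentence («the operators … are real», the solution of the real equation (116) is real; the complex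
  carriers only serve Prop. 9's analytic extension) as a theorem MODULO DISPLAYED ROWS: the `ev`-presented real sector `S.evHerm0` (the `Y` with
  `ev Y (b)` Hermitian and traceless on every bond, so that `i·ev Y (b) ∈ 𝔰𝔲(N)`), ★ `sol_mem_of_invariant` (the fixed point lies in every closed
  `mapT`-invariant set containing `0` — `B11Prop6Scheme.solution_mem_of_invariant` at the scheme's letters), ★★ `sol_mem_of_rows` ∕ `lieTokAt_of_rows`
  (ROWS form: real submodules `TY ⊆ 𝒴` (closed), `TZ ⊆ 𝒵` with `𝒢(V) : TZ → TY`, `W(V) : TY ∩ {‖·‖ < a₃} → TZ`, `J(V) ∈ TZ`, `𝔄(V) ∈ TY`, and the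
  Prop. 6 regime at `V` ⟹ `𝒜(V) ∈ TY`; `TY := evHerm0` ⟹ `LieTokAt V`).  The rows are the socket for the reality programme of the record letters
  (`Summits/…/BalabanUVNodesN07RecordLettersReality`: `starW`-reality of `hessOpOfRecord`, `QflatOfRecord`, …), which are NOT restated here.
* §3 THE FLAT VALUE AND REGULARITY — `sol_eq_zero` (`J(V) = 0`, `𝔄(V) = 0` and the regime ⟹ `𝒜(V) = 0`, `Regime.solA_zero`), `chartCfg_eq_bg`
  (then the chart image is the background itself: at the flat record datum `chartCfg 1 = 1`), and Cⁿ-dependence of `x ↦ S.lieExpo (u x)` and of the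
  chart matrix entries `x ↦ (S.chartCfg (u x))(b)` along any datum map `u : E → fields` from Cⁿ-dependence of the full small field
  `x ↦ 𝒜(u x) + 𝔄(u x)` (supplied at the record by (s1) `Node00.BgSchemeOfRecordC.analyticOnNhd_solOfRecordC` ∕ `analyticOnNhd_sol_add_shift_comp`).

WHY.  The K0 junction (`…K0AxJunctionRootGradScheme`, hypotheses `h1 : S.chartCfg 1 = 1`, `hdiff`∕`hC` : C¹∕C² chart entries at `B = 0`) and the
tangent socket (`FlatCriticalExpChartFamilyAt … X Ψ datum` with the chart family `B ↦ expChart 1 (X B)`) read the instance only through these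
letters; this file supplies them GENERICALLY over the scheme, so that every instance (the record scheme `bgSchemeOfRecord … U₀ …` of
`Node00.BgSchemeOfRecord`, its flat specialisation `U₀ = 1`, any level and `N`) consumes them by name with `X := S.lieExpo ∘ datum`.

HONEST.  Definitions with bodies and lemmas proved from them; the printed laws stay DISPLAYED (`RegimeTok`, the rows of §2, the regime at `V`);
nothing of [B11] ∕ [B9] is asserted; no lattice instance of the rows exists in the tree (census 2026-08-31: the record-letter reality lemmas of
`…N07RecordLettersReality` are the `starW`-form inputs from which a Summit-side file assembles the rows).  Not continuum, not OS, not Clay.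
-/

noncomputable section

namespace Literature.MathematicalPhysics.QuantumFieldTheory.Balaban1983to89.Node00

open _root_.Filter _root_.Topology
open scoped Matrix.Norms.L2Operator
open T4Continuum (T4Family)
open T4AdjointCovarianceUnitary (lieSU expSU coe_expSU mem_lieSU_iff exp_mem_specialUnitaryGroup_of_mem_lieSU)
open B9AdOrthogonal (herm0 mem_herm0)
open B11Eq174Chart (Regime solA)
open B11Prop6Scheme (mapT solution_mem_of_invariant)
open NormedSpace (exp)

namespace BgScheme

variable {F : T4Family} {N : ℕ}
variable {𝒴 𝒵 : Type} [NormedAddCommGroup 𝒴] [NormedSpace ℂ 𝒴] [NormedAddCommGroup 𝒵] [NormedSpace ℂ 𝒵]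
variable {K k : ℕ} (S : BgScheme F N 𝒴 𝒵 K k)

/-! ## §1. The Lie-algebra reading of the exponent and the seam with the exponential chart at `1` -/

/-- **THE EXPONENT READ IN `𝔰𝔲(N)`**: `lieExpo S V b = π(i·X(b))`, `X = ev(𝒜(V) + 𝔄(V))`, through the real-linear retraction `π = suProj N`
(identity on `𝔰𝔲(N)`): a total, real-linear-in-the-small-field reading of «U′ = exp(iηA′)»'s exponent; on `LieTokAt`'s fields it IS `i·X(b)`
(`coe_lieExpo`). [cite: Balaban1985Variational, (15) p.280, (19) p.281] -/
def lieExpo (V : GaugeField (F.P K) k (SU N)) (b : PBond (F.P K) 0) : lieSU (Fin N) :=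
  suProj N (Complex.I • S.ev (S.sol V + S.𝔄 V) b)

/-- **TOKEN (Lie form of the reality of the fixed point, at one field)**: the exponent `i·X(b)`, `X = ev(𝒜(V) + 𝔄(V))`, lies in `𝔰𝔲(N)` on every
bond — print's «U′ = exp(iηA′)» with `A′` a REAL (Hermitian, traceless-valued) field; supplied from real data by `lieTokAt_of_rows` (§2);
on the domain (`∀ V ∈ dom`) it is the Lie form of `ChartSUTok` (`chartSUTok_of_lieTokAt`).
[cite: Balaban1985Variational, (15) p.280, Prop. 6 p.295] -/
def LieTokAt (V : GaugeField (F.P K) k (SU N)) : Prop :=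
  ∀ b : PBond (F.P K) 0, Complex.I • S.ev (S.sol V + S.𝔄 V) b ∈ lieSU (Fin N)

variable {S}

/-- Under the token the Lie reading is transparent: the matrix of `lieExpo S V b` is `i·X(b)`. [cite: Balaban1985Variational, (15) p.280] -/
theorem coe_lieExpo {V : GaugeField (F.P K) k (SU N)} (h : S.LieTokAt V) (b : PBond (F.P K) 0) :
    ((S.lieExpo V b : lieSU (Fin N)) : Matrix (Fin N) (Fin N) ℂ) = Complex.I • S.ev (S.sol V + S.𝔄 V) b :=
  coe_suProj_of_mem (h b)

/-- Under the token the exponent `exp(iX(b))` is the exponential of the Lie reading. [cite: Balaban1985Variational, (15) p.280] -/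
theorem expo_eq_exp_coe_lieExpo {V : GaugeField (F.P K) k (SU N)} (h : S.LieTokAt V) (b : PBond (F.P K) 0) :
    S.expo V b = exp ((S.lieExpo V b : lieSU (Fin N)) : Matrix (Fin N) (Fin N) ℂ) := by
  rw [coe_lieExpo h b]
  rfl

/-- Under the token the exponent is `SU(N)`-valued: `exp(iX(b)) ∈ SU(N)` (`exp 𝔰𝔲(N) ⊆ SU(N)`). [cite: Balaban1985Variational, (15) p.280] -/
theorem expo_mem_of_lieTokAt {V : GaugeField (F.P K) k (SU N)} (h : S.LieTokAt V) (b : PBond (F.P K) 0) :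
    S.expo V b ∈ Matrix.specialUnitaryGroup (Fin N) ℂ :=
  exp_mem_specialUnitaryGroup_of_mem_lieSU (h b)

/-- Under the token `exp(iX(b))`, read in `SU(N)`, is `expSU` of the Lie reading. [cite: Balaban1985Variational, (15) p.280] -/
theorem suOfMat_expo_eq_expSU {V : GaugeField (F.P K) k (SU N)} (h : S.LieTokAt V) (b : PBond (F.P K) 0) :
    suOfMat N (S.expo V b) = expSU (S.lieExpo V b) := by
  rw [suOfMat_of_mem (expo_mem_of_lieTokAt h b)]
  exact Subtype.ext (expo_eq_exp_coe_lieExpo h b)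

/-- **The Lie form implies `ChartSUTok`** (the `SU(N)`-valuedness of the exponent on the domain). [cite: Balaban1985Variational, (15) p.280, Prop. 6 p.295] -/
theorem chartSUTok_of_lieTokAt (h : ∀ V ∈ S.dom, S.LieTokAt V) : S.ChartSUTok :=
  fun V hV b => expo_mem_of_lieTokAt (h V hV) b

/-- Under the token the matrix of the chart image is `exp(lieExpo(b)) · U₀(b)`. [cite: Balaban1985Variational, (15) p.280] -/
theorem coe_chartCfg_of_lieTokAt {V : GaugeField (F.P K) k (SU N)} (h : S.LieTokAt V) (b : PBond (F.P K) 0) :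
    ((S.chartCfg V b : SU N) : Matrix (Fin N) (Fin N) ℂ) =
      exp ((S.lieExpo V b : lieSU (Fin N)) : Matrix (Fin N) (Fin N) ℂ) * ((S.bg V b : SU N) : Matrix (Fin N) (Fin N) ℂ) := by
  rw [S.coe_chartCfg_of_mem (expo_mem_of_lieTokAt h b), expo_eq_exp_coe_lieExpo h b]

section Seam

variable [NeZero N]

/-- **★ THE SEAM «(s-exp)» AT A FLAT BACKGROUND**: if `U₀ = bg V = 1` and the exponent is `𝔰𝔲(N)`-valued, the chart image of the fixed point IS the
exponential chart at `1` of its Lie reading: `S.chartCfg V = expChart 1 (S.lieExpo V)` («U = U′U₀ = exp(iηA′)» at `U₀ = 1`).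
[cite: Balaban1985Variational, (15) p.280, (19) p.281] -/
theorem chartCfg_eq_expChart_one {V : GaugeField (F.P K) k (SU N)} (hbg : S.bg V = 1) (h : S.LieTokAt V) :
    S.chartCfg V = expChart 1 (S.lieExpo V) := by
  funext b
  show suOfMat N (S.expo V b) * S.bg V b = (1 : GaugeField (F.P K) 0 (SU N)) b * expSU (S.lieExpo V b)
  rw [suOfMat_expo_eq_expSU h b, hbg, show (1 : GaugeField (F.P K) 0 (SU N)) b = 1 from rfl, mul_one, one_mul]

/-- (s-exp), matrix form at a flat background: `(chartCfg V)(b) = exp(lieExpo(b))`. [cite: Balaban1985Variational, (15) p.280] -/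
theorem coe_chartCfg_of_lieTokAt_of_bg_eq_one {V : GaugeField (F.P K) k (SU N)} (hbg : S.bg V = 1) (h : S.LieTokAt V) (b : PBond (F.P K) 0) :
    ((S.chartCfg V b : SU N) : Matrix (Fin N) (Fin N) ℂ) = exp ((S.lieExpo V b : lieSU (Fin N)) : Matrix (Fin N) (Fin N) ℂ) := by
  rw [coe_chartCfg_of_lieTokAt h b, hbg, show (1 : GaugeField (F.P K) 0 (SU N)) b = 1 from rfl, OneMemClass.coe_one, mul_one]

/-- **(s-exp) ALONG A DATUM MAP, eventual form**: for a datum map `u` into flat-background fields (`bg (u x) = 1`) on which the Lie token holds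
eventually along a filter `l`, the chart family IS eventually the exponential-chart family of the Lie readings:
`S.chartCfg ∘ u =ᶠ[l] (x ↦ expChart 1 (S.lieExpo (u x)))` — the form the K0 tangent socket consumes (it reads only the germ at the flat datum).
[cite: Balaban1985Variational, (15) p.280, (19) p.281] -/
theorem chartCfg_comp_eventuallyEq_expChart {E : Type*} {l : Filter E} {u : E → GaugeField (F.P K) k (SU N)}
    (hbg : ∀ x, S.bg (u x) = 1) (h : ∀ᶠ x in l, S.LieTokAt (u x)) :
    (fun x => S.chartCfg (u x)) =ᶠ[l] fun x => expChart 1 (S.lieExpo (u x)) :=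
  h.mono fun x hx => chartCfg_eq_expChart_one (hbg x) hx

/-- (s-exp) along a datum map, pointwise form under the token everywhere. [cite: Balaban1985Variational, (15) p.280] -/
theorem chartCfg_comp_eq_expChart {E : Type*} {u : E → GaugeField (F.P K) k (SU N)}
    (hbg : ∀ x, S.bg (u x) = 1) (h : ∀ x, S.LieTokAt (u x)) :
    (fun x => S.chartCfg (u x)) = fun x => expChart 1 (S.lieExpo (u x)) :=
  funext fun x => chartCfg_eq_expChart_one (hbg x) (h x)

end Seam

/-! ## §2. Reality of the data ⟹ the Lie token -/

/-- `i·A ∈ 𝔰𝔲(N)` for a Hermitian traceless matrix `A` (the real field `ηA′(b)` ↦ the exponent `iηA′(b)` of «U′ = exp(iηA′)»).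
[cite: Balaban1985Variational, (15) p.280 (bookkeeping); Balaban1985Averaging, (17)–(19) p.21 (bookkeeping)] -/
theorem I_smul_mem_lieSU_of_mem_herm0 {A : Matrix (Fin N) (Fin N) ℂ} (hA : A ∈ herm0 (Fin N)) : Complex.I • A ∈ lieSU (Fin N) := by
  rw [mem_herm0] at hA
  rw [mem_lieSU_iff]
  refine ⟨?_, ?_⟩
  · rw [star_smul, Complex.star_def, Complex.conj_I, Matrix.star_eq_conjTranspose, hA.1.eq, neg_smul]
  · rw [Matrix.trace_smul, hA.2, smul_zero]

variable (S) in
/-- **THE `ev`-PRESENTED REAL SECTOR of the (115)-space**: the `Y` whose presentation `ev Y (b)` is Hermitian and traceless on every bond (the real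
fields `ηA′` of print inside the complex carrier), a real submodule. [cite: Balaban1985Variational, (115) p.295, Prop. 9 p.309] -/
def evHerm0 : Submodule ℝ 𝒴 :=
  (Submodule.pi Set.univ fun _ : PBond (F.P K) 0 => herm0 (Fin N)).comap (S.ev.restrictScalars ℝ)

/-- Membership in the real sector. [cite: Balaban1985Variational, (115) p.295] -/
theorem mem_evHerm0_iff {Y : 𝒴} : Y ∈ S.evHerm0 ↔ ∀ b : PBond (F.P K) 0, S.ev Y b ∈ herm0 (Fin N) := by
  simp only [evHerm0, Submodule.mem_comap, LinearMap.coe_restrictScalars, Submodule.mem_pi, Set.mem_univ, true_implies]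

/-- **Real small field ⟹ Lie token**: if `𝒜(V)` and `𝔄(V)` lie in the real sector, the exponent `i·ev(𝒜 + 𝔄)(b)` lies in `𝔰𝔲(N)` on every bond.
[cite: Balaban1985Variational, (15) p.280, Prop. 6 p.295] -/
theorem lieTokAt_of_mem_evHerm0 {V : GaugeField (F.P K) k (SU N)} (hsol : S.sol V ∈ S.evHerm0) (h𝔄 : S.𝔄 V ∈ S.evHerm0) : S.LieTokAt V := by
  intro b
  have hmem : S.sol V + S.𝔄 V ∈ S.evHerm0 := add_mem hsol h𝔄
  exact I_smul_mem_lieSU_of_mem_herm0 ((mem_evHerm0_iff.1 hmem) b)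

/-- The fixed point lies in the ball (115) and solves (116), under the regime at `V` (the scheme's `solA_mem` at the letters).
[cite: Balaban1985Variational, Prop. 6 (115)–(116) p.295] -/
theorem sol_spec [CompleteSpace 𝒴] {V : GaugeField (F.P K) k (SU N)}
    (R : Regime (S.𝒢 V) 0 (S.W V) S.B₀ 0 S.C₄ S.a₃ S.j S.a S.ε₄) (hJ : ‖S.J V‖ ≤ S.j) (h𝔄 : ‖S.𝔄 V‖ < S.a) :
    ‖S.sol V‖ ≤ S.ε₄ ∧ mapT (S.𝒢 V) 0 (S.W V) (S.J V) (S.𝔄 V) (S.sol V) = S.sol V :=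
  R.solA_mem hJ h𝔄

/-- On the domain, under `RegimeTok`, the fixed point lies in the ball and solves (116). [cite: Balaban1985Variational, Prop. 6 (115)–(116) p.295] -/
theorem sol_spec_of_regimeTok [CompleteSpace 𝒴] (hR : S.RegimeTok) {V : GaugeField (F.P K) k (SU N)} (hV : V ∈ S.dom) :
    ‖S.sol V‖ ≤ S.ε₄ ∧ mapT (S.𝒢 V) 0 (S.W V) (S.J V) (S.𝔄 V) (S.sol V) = S.sol V :=
  sol_spec (hR V hV).1 (hR V hV).2.1 (hR V hV).2.2

/-- **★ THE FIXED POINT LIES IN EVERY CLOSED `mapT`-INVARIANT SET CONTAINING `0`** (the contraction (116) runs inside it —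
`B11Prop6Scheme.solution_mem_of_invariant` at the scheme's letters): the engine of the constraint-space and reality conclusions.
[cite: Balaban1985Variational, Prop. 6 (116)–(121) p.295] -/
theorem sol_mem_of_invariant [CompleteSpace 𝒴] {V : GaugeField (F.P K) k (SU N)}
    (R : Regime (S.𝒢 V) 0 (S.W V) S.B₀ 0 S.C₄ S.a₃ S.j S.a S.ε₄) (hJ : ‖S.J V‖ ≤ S.j) (h𝔄 : ‖S.𝔄 V‖ < S.a)
    (T : Set 𝒴) (hT : IsClosed T) (h0 : (0 : 𝒴) ∈ T)
    (hinv : ∀ X ∈ T, ‖X‖ ≤ S.ε₄ → mapT (S.𝒢 V) 0 (S.W V) (S.J V) (S.𝔄 V) X ∈ T) : S.sol V ∈ T := by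
  have hm := sol_spec R hJ h𝔄
  exact solution_mem_of_invariant R.norm_G R.norm_L R.quad R.B₀_nonneg R.C₄_nonneg R.θ_nonneg hJ h𝔄 R.ε₄_nonneg R.dom R.self R.contr
    T hT h0 hinv hm.1 hm.2

/-- **★★ THE FIXED POINT IS REAL WHEN THE DATA ARE (rows form)**: real sectors `TY ⊆ 𝒴` (closed), `TZ ⊆ 𝒵` with the ROWS «𝒢(V) maps `TZ` into `TY`»,
«`W(V)` maps `TY ∩ {‖·‖ < a₃}` into `TZ`», «`J(V) ∈ TZ`», «`𝔄(V) ∈ TY`» (print: the operators 𝔊(U₀), (δ∕δA′)V and the current are real) and the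
Prop. 6 regime at `V` give `𝒜(V) ∈ TY`. [cite: Balaban1985Variational, Prop. 6 (116)–(121) p.295, (80) p.290, (26)–(28) p.282] -/
theorem sol_mem_of_rows [CompleteSpace 𝒴] {V : GaugeField (F.P K) k (SU N)}
    (R : Regime (S.𝒢 V) 0 (S.W V) S.B₀ 0 S.C₄ S.a₃ S.j S.a S.ε₄) (hJ : ‖S.J V‖ ≤ S.j) (h𝔄 : ‖S.𝔄 V‖ < S.a)
    (TY : Submodule ℝ 𝒴) (hTY : IsClosed (TY : Set 𝒴)) (TZ : Submodule ℝ 𝒵)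
    (h𝒢 : ∀ f ∈ TZ, S.𝒢 V f ∈ TY) (hW : ∀ X ∈ TY, ‖X‖ < S.a₃ → S.W V X ∈ TZ) (hJT : S.J V ∈ TZ) (h𝔄T : S.𝔄 V ∈ TY) :
    S.sol V ∈ TY := by
  have ha : 0 < S.a := (norm_nonneg _).trans_lt h𝔄
  refine sol_mem_of_invariant R hJ h𝔄 (TY : Set 𝒴) hTY TY.zero_mem fun X hX hXn => ?_
  have hXA : X + S.𝔄 V ∈ TY := add_mem hX h𝔄T
  have hXAn : ‖X + S.𝔄 V‖ < S.a₃ := by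
    have h1 : ‖X + S.𝔄 V‖ ≤ ‖X‖ + ‖S.𝔄 V‖ := norm_add_le _ _
    have h2 : S.ε₄ + S.a ≤ S.a₃ := by linarith [R.dom, R.ε₄_nonneg]
    linarith
  have hGW : S.𝒢 V (S.W V (X + S.𝔄 V)) ∈ TY := h𝒢 _ (hW _ hXA hXAn)
  have hGJ : S.𝒢 V (S.J V) ∈ TY := h𝒢 _ hJT
  show mapT (S.𝒢 V) 0 (S.W V) (S.J V) (S.𝔄 V) X ∈ (TY : Set 𝒴)
  rw [B11Prop6Scheme.mapT_noLinear]
  exact sub_mem (neg_mem hGJ) hGW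

/-- **★★ REAL DATA ⟹ THE LIE TOKEN** (rows form with `TY :=` the `ev`-presented real sector): the rows for `evHerm0` and some real current sector
`TZ`, and the regime at `V`, give `i·X(b) ∈ 𝔰𝔲(N)` on every bond — hence `exp(iX(b)) ∈ SU(N)` and (s-exp).  `TZ` is a free parameter (any real
current sector that `𝒢(V)` maps into `evHerm0`); at the record scheme the `J`-row «`J(U₀) ∈ TZ`» with `TZ` the Hermitian TRACELESS currents is
inhabited at `N = 2` (`Node00.BgCurrentOfRecord.star_JOfRecordAtBg_apply` + `Summits/…/BalabanUVNodesN07JOfRecordGaugeCovariance`'s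
`trace_JOfRecordAtBg_apply_two`) and on the flat orbit, and is
DISPLAYED at `N ≥ 3` (the tree's current letter keeps a scalar channel there); no unconditional `LieTokAt` is claimed anywhere.
[cite: Balaban1985Variational, (15) p.280, Prop. 6 (116)–(121) p.295, (26)–(28) p.282] -/
theorem lieTokAt_of_rows [CompleteSpace 𝒴] {V : GaugeField (F.P K) k (SU N)}
    (R : Regime (S.𝒢 V) 0 (S.W V) S.B₀ 0 S.C₄ S.a₃ S.j S.a S.ε₄) (hJ : ‖S.J V‖ ≤ S.j) (h𝔄 : ‖S.𝔄 V‖ < S.a)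
    (hcl : IsClosed (S.evHerm0 : Set 𝒴)) (TZ : Submodule ℝ 𝒵)
    (h𝒢 : ∀ f ∈ TZ, S.𝒢 V f ∈ S.evHerm0) (hW : ∀ X ∈ S.evHerm0, ‖X‖ < S.a₃ → S.W V X ∈ TZ) (hJT : S.J V ∈ TZ)
    (h𝔄T : S.𝔄 V ∈ S.evHerm0) : S.LieTokAt V :=
  lieTokAt_of_mem_evHerm0 (sol_mem_of_rows R hJ h𝔄 S.evHerm0 hcl TZ h𝒢 hW hJT h𝔄T) h𝔄T

/-- **The Lie token on the whole domain from uniform rows** (`RegimeTok` + the rows at every `V ∈ dom`) — the Lie form of `ChartSUTok`, which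
follows by `chartSUTok_of_lieTokAt`. [cite: Balaban1985Variational, Prop. 6 p.295, (15) p.280] -/
theorem lieTokAt_of_regimeTok_of_rows [CompleteSpace 𝒴] (hR : S.RegimeTok) (hcl : IsClosed (S.evHerm0 : Set 𝒴))
    (TZ : GaugeField (F.P K) k (SU N) → Submodule ℝ 𝒵)
    (h𝒢 : ∀ V ∈ S.dom, ∀ f ∈ TZ V, S.𝒢 V f ∈ S.evHerm0) (hW : ∀ V ∈ S.dom, ∀ X ∈ S.evHerm0, ‖X‖ < S.a₃ → S.W V X ∈ TZ V)
    (hJT : ∀ V ∈ S.dom, S.J V ∈ TZ V) (h𝔄T : ∀ V ∈ S.dom, S.𝔄 V ∈ S.evHerm0) : ∀ V ∈ S.dom, S.LieTokAt V :=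
  fun V hV => lieTokAt_of_rows (hR V hV).1 (hR V hV).2.1 (hR V hV).2.2 hcl (TZ V) (h𝒢 V hV) (hW V hV) (hJT V hV) (h𝔄T V hV)

/-- In a finite-dimensional carrier the real sector is closed (every real submodule is) — the closedness premise of `sol_mem_of_rows` at the record's
(115)-space. [cite: Balaban1985Variational, (115) p.295 (bookkeeping)] -/
theorem isClosed_evHerm0 [FiniteDimensional ℂ 𝒴] : IsClosed (S.evHerm0 : Set 𝒴) := by
  haveI : FiniteDimensional ℝ 𝒴 := FiniteDimensional.complexToReal 𝒴
  exact Submodule.closed_of_finiteDimensional _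

/-! ## §3. The flat value and the regularity of the chart entries along a datum map -/

/-- **FLAT DATA ⟹ ZERO FIXED POINT**: `J(V) = 0`, `𝔄(V) = 0` and the regime at `V` give `𝒜(V) = 0` (`0` solves (116) at zero data; uniqueness).
[cite: Balaban1985Variational, Prop. 6 p.295, Prop. 9 p.309] -/
theorem sol_eq_zero [CompleteSpace 𝒴] {V : GaugeField (F.P K) k (SU N)}
    (R : Regime (S.𝒢 V) 0 (S.W V) S.B₀ 0 S.C₄ S.a₃ S.j S.a S.ε₄) (hj : 0 ≤ S.j) (ha : 0 < S.a) (hJ : S.J V = 0) (h𝔄 : S.𝔄 V = 0) :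
    S.sol V = 0 := by
  show solA (S.𝒢 V) 0 (S.W V) (S.J V) S.ε₄ (S.𝔄 V) = 0
  rw [hJ, h𝔄]
  exact R.solA_zero hj ha

/-- Zero small field ⟹ zero Lie reading. [cite: Balaban1985Variational, (15) p.280] -/
theorem lieExpo_eq_zero {V : GaugeField (F.P K) k (SU N)} (hsol : S.sol V = 0) (h𝔄 : S.𝔄 V = 0) : S.lieExpo V = 0 := by
  funext b
  simp only [lieExpo, hsol, h𝔄, add_zero, map_zero, Pi.zero_apply, smul_zero]

/-- Zero small field ⟹ the Lie token holds (trivially: `0 ∈ 𝔰𝔲(N)`). [cite: Balaban1985Variational, (15) p.280] -/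
theorem lieTokAt_of_sol_eq_zero {V : GaugeField (F.P K) k (SU N)} (hsol : S.sol V = 0) (h𝔄 : S.𝔄 V = 0) : S.LieTokAt V := by
  intro b
  rw [hsol, h𝔄, add_zero, map_zero, Pi.zero_apply, smul_zero]
  exact Submodule.zero_mem _

/-- Zero small field ⟹ unit exponent `exp(i·0) = 1`. [cite: Balaban1985Variational, (15) p.280] -/
theorem expo_eq_one {V : GaugeField (F.P K) k (SU N)} (hsol : S.sol V = 0) (h𝔄 : S.𝔄 V = 0) (b : PBond (F.P K) 0) : S.expo V b = 1 := by
  show exp (Complex.I • S.ev (S.sol V + S.𝔄 V) b) = 1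
  rw [hsol, h𝔄, add_zero, map_zero, Pi.zero_apply, smul_zero, NormedSpace.exp_zero]

/-- **ZERO SMALL FIELD ⟹ THE CHART IMAGE IS THE BACKGROUND**: `chartCfg V = bg V` («U = U′U₀» with `U′ = 1`); at the flat record datum
(`U₀ = 1`, `J(1) = 0`, `𝔄(1) = 0`) this is the junction's `chartCfg 1 = 1`. [cite: Balaban1985Variational, (15) p.280, Prop. 9 p.309] -/
theorem chartCfg_eq_bg {V : GaugeField (F.P K) k (SU N)} (hsol : S.sol V = 0) (h𝔄 : S.𝔄 V = 0) : S.chartCfg V = S.bg V := by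
  funext b
  rw [chartCfg_apply, expo_eq_one hsol h𝔄 b, ← OneMemClass.coe_one (Matrix.specialUnitaryGroup (Fin N) ℂ : Submonoid _)]
  show suOfMat N (((1 : SU N)) : Matrix (Fin N) (Fin N) ℂ) * S.bg V b = S.bg V b
  rw [suOfMat_coe, one_mul]

/-- Flat data under the regime ⟹ the chart image is the background. [cite: Balaban1985Variational, (15) p.280, Prop. 9 p.309] -/
theorem chartCfg_eq_bg_of_regime [CompleteSpace 𝒴] {V : GaugeField (F.P K) k (SU N)}
    (R : Regime (S.𝒢 V) 0 (S.W V) S.B₀ 0 S.C₄ S.a₃ S.j S.a S.ε₄) (hj : 0 ≤ S.j) (ha : 0 < S.a) (hJ : S.J V = 0) (h𝔄 : S.𝔄 V = 0) :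
    S.chartCfg V = S.bg V :=
  chartCfg_eq_bg (sol_eq_zero R hj ha hJ h𝔄) h𝔄

section Regularity

variable {E : Type*} [NormedAddCommGroup E] [NormedSpace ℝ E]

variable (S) in
/-- The presentation `ev`, continuous, as a real continuous linear map (bookkeeping for the calculus along datum maps). [cite: Balaban1985Variational, (115) p.295 (bookkeeping)] -/
def evR (hev : Continuous S.ev) : 𝒴 →L[ℝ] (PBond (F.P K) 0 → Matrix (Fin N) (Fin N) ℂ) :=
  { S.ev.restrictScalars ℝ with cont := hev }

omit [NormedSpace ℝ E] in
/-- Unfolding of `evR`. [cite: Balaban1985Variational, (115) p.295 (bookkeeping)] -/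
@[simp] theorem evR_apply (hev : Continuous S.ev) (Y : 𝒴) : S.evR hev Y = S.ev Y := rfl

/-- **Cⁿ OF THE LIE READING ALONG A DATUM MAP**: if the full small field `x ↦ 𝒜(u x) + 𝔄(u x)` is `Cⁿ` at `x₀` (print: analytic — Prop. 9) and the
presentation is continuous, `x ↦ lieExpo S (u x)` is `Cⁿ` at `x₀`. [cite: Balaban1985Variational, Prop. 9 p.309, (15) p.280] -/
theorem contDiffAt_lieExpo_comp {n : WithTop ℕ∞} (hev : Continuous S.ev) {u : E → GaugeField (F.P K) k (SU N)} {x₀ : E}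
    (hd : ContDiffAt ℝ n (fun x => S.sol (u x) + S.𝔄 (u x)) x₀) :
    ContDiffAt ℝ n (fun x => S.lieExpo (u x)) x₀ := by
  have hev' : ContDiffAt ℝ n (fun x => S.ev (S.sol (u x) + S.𝔄 (u x))) x₀ :=
    ((S.evR hev).contDiff.contDiffAt).comp x₀ hd
  refine contDiffAt_pi.2 fun b => ?_
  have hb : ContDiffAt ℝ n (fun x => S.ev (S.sol (u x) + S.𝔄 (u x)) b) x₀ := contDiffAt_pi.1 hev' b
  have hI : ContDiffAt ℝ n (fun x => Complex.I • S.ev (S.sol (u x) + S.𝔄 (u x)) b) x₀ := hb.const_smul Complex.I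
  exact ((suProj N).contDiff.contDiffAt).comp x₀ hI

/-- Differentiability of the Lie reading along a datum map (the `C¹` case). [cite: Balaban1985Variational, Prop. 9 p.309, (15) p.280] -/
theorem differentiableAt_lieExpo_comp (hev : Continuous S.ev) {u : E → GaugeField (F.P K) k (SU N)} {x₀ : E}
    (hd : ContDiffAt ℝ 1 (fun x => S.sol (u x) + S.𝔄 (u x)) x₀) :
    DifferentiableAt ℝ (fun x => S.lieExpo (u x)) x₀ :=
  (contDiffAt_lieExpo_comp hev hd).differentiableAt one_ne_zero

/-- The matrix exponential of «U′ = exp(iηA′)» is smooth (real scalars) on `M_N(ℂ)`. [cite: Balaban1985Variational, (15) p.280 (bookkeeping)] -/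
theorem contDiffAt_exp_matrix {n : WithTop ℕ∞} (A : Matrix (Fin N) (Fin N) ℂ) :
    ContDiffAt ℝ n (fun B : Matrix (Fin N) (Fin N) ℂ => exp B) A :=
  ((NormedSpace.exp_analytic (𝕂 := ℂ) A).contDiffAt (n := n)).restrict_scalars ℝ

/-- **Cⁿ OF THE EXPONENT ALONG A DATUM MAP**: `x ↦ exp(iX(u x)(b))` is `Cⁿ` at `x₀` under the same premises. [cite: Balaban1985Variational, Prop. 9 p.309, (15) p.280] -/
theorem contDiffAt_expo_comp {n : WithTop ℕ∞} (hev : Continuous S.ev) {u : E → GaugeField (F.P K) k (SU N)} {x₀ : E}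
    (hd : ContDiffAt ℝ n (fun x => S.sol (u x) + S.𝔄 (u x)) x₀) (b : PBond (F.P K) 0) :
    ContDiffAt ℝ n (fun x => S.expo (u x) b) x₀ := by
  have hev' : ContDiffAt ℝ n (fun x => S.ev (S.sol (u x) + S.𝔄 (u x))) x₀ :=
    ((S.evR hev).contDiff.contDiffAt).comp x₀ hd
  have hI : ContDiffAt ℝ n (fun x => Complex.I • S.ev (S.sol (u x) + S.𝔄 (u x)) b) x₀ := (contDiffAt_pi.1 hev' b).const_smul Complex.I
  exact (contDiffAt_exp_matrix _).comp x₀ hI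

/-- **★ Cⁿ OF THE CHART MATRIX ENTRIES ALONG A DATUM MAP** (◆'s «C² chart entries at 0»): for a datum map `u` into fields with a CONSTANT background
`bg (u x) = U₀` on which the Lie token holds near `x₀`, and a `Cⁿ` full small field, `x ↦ (chartCfg (u x))(b) = exp(iX(b))·U₀(b)` is `Cⁿ` at `x₀`.
[cite: Balaban1985Variational, Prop. 9 p.309, (15) p.280] -/
theorem contDiffAt_coe_chartCfg_comp {n : WithTop ℕ∞} (hev : Continuous S.ev) {u : E → GaugeField (F.P K) k (SU N)} {x₀ : E}
    {U₀ : GaugeField (F.P K) 0 (SU N)} (hbg : ∀ x, S.bg (u x) = U₀) (htok : ∀ᶠ x in 𝓝 x₀, S.LieTokAt (u x))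
    (hd : ContDiffAt ℝ n (fun x => S.sol (u x) + S.𝔄 (u x)) x₀) (b : PBond (F.P K) 0) :
    ContDiffAt ℝ n (fun x => ((S.chartCfg (u x) b : SU N) : Matrix (Fin N) (Fin N) ℂ)) x₀ := by
  have heq : (fun x => ((S.chartCfg (u x) b : SU N) : Matrix (Fin N) (Fin N) ℂ)) =ᶠ[𝓝 x₀]
      fun x => S.expo (u x) b * ((U₀ b : SU N) : Matrix (Fin N) (Fin N) ℂ) :=
    htok.mono fun x hx => show ((S.chartCfg (u x) b : SU N) : Matrix (Fin N) (Fin N) ℂ) = S.expo (u x) b * ((U₀ b : SU N) : Matrix (Fin N) (Fin N) ℂ) by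
      rw [S.coe_chartCfg_of_mem (expo_mem_of_lieTokAt hx b), hbg x]
  exact ((contDiffAt_expo_comp hev hd b).mul contDiffAt_const).congr_of_eventuallyEq heq

/-- The chart matrix entries as ONE map into bond-indexed matrices are `Cⁿ` at `x₀` (the shape `hC`∕`hdiff` of the K0 junction).
[cite: Balaban1985Variational, Prop. 9 p.309, (15) p.280] -/
theorem contDiffAt_coe_chartCfg_comp_pi {n : WithTop ℕ∞} (hev : Continuous S.ev) {u : E → GaugeField (F.P K) k (SU N)} {x₀ : E}
    {U₀ : GaugeField (F.P K) 0 (SU N)} (hbg : ∀ x, S.bg (u x) = U₀) (htok : ∀ᶠ x in 𝓝 x₀, S.LieTokAt (u x))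
    (hd : ContDiffAt ℝ n (fun x => S.sol (u x) + S.𝔄 (u x)) x₀) :
    ContDiffAt ℝ n (fun x (b : PBond (F.P K) 0) => ((S.chartCfg (u x) b : SU N) : Matrix (Fin N) (Fin N) ℂ)) x₀ :=
  contDiffAt_pi.2 fun b => contDiffAt_coe_chartCfg_comp hev hbg htok hd b

/-- Differentiability of the chart matrix entries along a datum map (the `C¹` case; the junction's `hdiff`). [cite: Balaban1985Variational, Prop. 9 p.309, (15) p.280] -/
theorem differentiableAt_coe_chartCfg_comp_pi (hev : Continuous S.ev) {u : E → GaugeField (F.P K) k (SU N)} {x₀ : E}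
    {U₀ : GaugeField (F.P K) 0 (SU N)} (hbg : ∀ x, S.bg (u x) = U₀) (htok : ∀ᶠ x in 𝓝 x₀, S.LieTokAt (u x))
    (hd : ContDiffAt ℝ 1 (fun x => S.sol (u x) + S.𝔄 (u x)) x₀) :
    DifferentiableAt ℝ (fun x (b : PBond (F.P K) 0) => ((S.chartCfg (u x) b : SU N) : Matrix (Fin N) (Fin N) ℂ)) x₀ :=
  (contDiffAt_coe_chartCfg_comp_pi hev hbg htok hd).differentiableAt one_ne_zero

end Regularity

end BgScheme

end Literature.MathematicalPhysics.QuantumFieldTheory.Balaban1983to89.Node00
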